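import Summits.QuantumFields.YangMills.Theorems.BalabanUVNodesN11CondLawInFibreChartIntegrable
import Summits.QuantumFields.YangMills.Theorems.BalabanUVNodesN11InnerPrivateCoordinateChartSocket

/-!
# DAG node N11 — THE KERNEL-LEVEL SOCKET AT THE RECORD INHABITED BY THE INNER PRIVATE-COORDINATE CHART: def-T's (†) for ALL new sequences at once =
# `𝐓^{(k)}` (11a's `kernelRTOfRecord`, outside bonds, TRUE conditional law) applied to the honest `dU_in`-integral over resampled INNER central bonds

HEADER.  Cell `pub-ymgap`, YM-PLAN Track A (D-0062), seat `pub-ymgap-dag-n08-w2` (g8; WIDTH SEAT 2∕4 on N08 [B10], RE-POINTED to N11's [III] §3-supply residue), route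
`BalabanUVNodes`, key K1⁷ `StabilityBAtRecordR13SepCoPH` = stmt-QuantumFields-20542 (helper lane `--supports 20542 --as helper` — jail key; K1⁹ 27364 of record, mis-key rule;
count-neutral; (B4)-socket bookkeeping).  [I] = [Balaban1987RG1], [III] = [Balaban1988Convergent].  FILE 9 of this seat's kernel-level socket (FILE 1 p611747 · FILE 2 p618553 ·
FILE 3 p615387 · FILE 5 p621159 · FILE 6 `…CondLawInFibreChartAtRecord` p624196 · FILE 7 p622706 · FILE 8 `…CondLawInFibreChartIntegrable` p627313).  INHABITANT BY NAME:
dag-n11-w6 g2's `…N11InnerPrivateCoordinateChartSocket` (`hpush_innerPrivateChart`, `hfib_innerPrivateChart`, `measurable_innerPrivateChart`, `measurable_innerPrivateJacobian`, over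
dag-n09-w6 g3's `T4TriangularFibredChart` and their own `…PrivateCoordinateChartKeptParameter`); dag-n11-e g21's `Node00/AveragingSkewPresentation` (`avOfRecord_glue_eq_glue`).
Companion (per-density road through `e_α`, CITED): dag-n11-w6 g2's `…N11InnerTransportInPrivateCoordinateChart` over dag-n11-d g14's `…N11TStepOfRecordSeparated`.

WHY.  FILE 6 ★★★ keys the record-level `hchart` on FILE 4's FIBREWISE inside charts; a chart seat may instead deliver dag-n11-d's shape — ONE windowed chart (`hpush ∧ hfib`) of the
INNER STEP `q ↦ (q.1, a_in q)` w.r.t. the middle reference `Π_{sV} Haar ⊗ Π_{sV′ᶜ} Haar`.  §1 gives the `hchartf` edition of FILE 6 ★★★ (FILE 1 `chart_of_map_eq_restrict` feeds it;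
FILE 3 ★★★ composes with the un-charted outer step `avgRestrOfRecord × id`; FILE 6 §1 transports along both glues with n11-e's intertwining).  §2 INHABITS it with dag-n11-w6's
inner private-coordinate chart: resample ONLY the central bonds `β(c)`, `c ∉ sV′` (inside∕boundary coarse bonds — `hβ′`: they lie off `sV`) by the displayed per-bond inverses
`ϑ_c` with windows `Ω_c`, `T_c` and Jacobian factors `j_c`; fibre reference = the off-`sV` product Haar itself (constant kernel).  §3 is the END of this seat's road: FILE 8 ★★★ at
that chart — for `dV′`-a.e. `V′` and EVERY `s′`, `(𝐓e^A)_{k+1}(s′)(V′) = kernelRTOfRecord F N K k sV sV′ (y ↦ ∫ dU_in 𝟙[∀ c ∉ sV′, r c ∈ T_c]·∏ j_c · (w(s′)(·,V′)·χ_k·T)(e_sV⁻¹(y,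
extend β′ (ϑ_c(·, r c))_c U_in))) o`, `(o, r) = e_α⁻¹V′`: [III] (2.21)∕(3.1) «`∫dV_k|_{Ω^c_{k+1}} δ(V̄_kV_{k+1}⁻¹) … ∫dU|_{Ω_{k+1}} …`» with the INSIDE δ-functions removed by SOLVING
`Ū′(c) = V′(c)` for the inside central bonds — support clause on the INNER bonds only (where (3.2)–(3.5) force smallness), GRAPH integrability only, no `∘ e_α`, null set uniform in `s′`.

CONTENTS (0 `def`, 0 `sorry`): §1 ★★★ `chart_avOfRecord_of_innerChart` · §2 ★★★ `chart_avOfRecord_innerPrivateChart` · §3 ★★★ `ae_forall_tstepOfRecord_eq_kernelRTOfRecord_innerPrivateChart`.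

HONEST FRAMING.  Helper lane (aside key); count-neutral; by-name compositions of landed measure theory; the per-bond inversion data `(Ω, T, ϑ, j; hΩm hTm hθm hjm hΩbl hright hlaw)`,
`hβ′`, `hY`, `hsV`∕`hsV′`, `hac_out` (n11-e's ★★ at the bond sets of record), the step weights' support clause and the graph integrability are HYPOTHESES, displayed; NO chart of
Bałaban's (exp ∕ (47) ∕ `C`, [III] (3.10)–(3.15)) constructed, NO Jacobian computed — the private-coordinate chart is a VALID chart of the disintegration, not the one after which
(3.23)'s Gaussian form appears (dag-n11-e's caveat); nothing of Bałaban asserted; (B4)∕(S-α)∕(O3′) NOT closed; N11 NOT discharged; N08 untouched; K1⁷∕K1⁸∕K1⁹ NOT closed, no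
registered stub touched; counts unmoved (typed 28∕28 · discharged 5∕27 · A 5∕28).  One finite `𝕋⁴_{L^K}` programme at fixed `ε = L^{−K}`; R4 closes only the conditional finite-𝕋⁴
rung `BalabanLadder.UV` — NOT ℝ⁴, NOT OS, NOT a mass gap, NOT Clay.  No `sorry`, `axiom`, `def`, `instance`, `notation`.  Sources (SHAPE only): [I] (0.4) p.253, (2.4) p.266, (2.9)–(2.10)
p.267; [III] (2.18) p.257, (2.21) p.258, (3.1) p.264, (3.2)–(3.5) p.265, (3.10)–(3.11) p.266, p.267 L18–24.
-/

noncomputable section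

open MeasureTheory ProbabilityTheory Set Function
open scoped ENNReal NNReal

namespace Summit.QuantumFields.YangMills.Theorems.BalabanUVNodesN11TStepInnerPrivateCoordinateChart

open Literature.MathematicalPhysics.QuantumFieldTheory.Balaban1983to89
open Literature.MathematicalPhysics.QuantumFieldTheory.Balaban1983to89.T4AveragingDisintegration
open Literature.MathematicalPhysics.QuantumFieldTheory.Balaban1983to89.BlockAveragingHaarAC (centralBond centralBond_injective isLocal_avgFun)
open BalabanUVNodesN11CondLawInFibreChart BalabanUVNodesN11CondLawInFibreChartComposition BalabanUVNodesN11CondLawInFibreChartSkewAssembly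
open BalabanUVNodesN11CondLawInFibreChartAtRecord BalabanUVNodesN11CondLawInFibreChartIntegrable BalabanUVNodesN11TStepInFibreChart
open BalabanUVNodesN11InnerPrivateCoordinateChartSocket
open BalabanUVNodesN11TransportOfRecordInPrivateCoordinateChart (succ_le_m_add_K)

/-! ## §1  AT THE RECORD: the kernel-level socket from a WINDOWED CHART OF THE INNER STEP in the glue coordinates (FILE 3 ★★★ + FILE 6 §1; FILE 4's fibrewise family is one producer) -/

section Record

open Node00 hiding SU
open T4Continuum
open B10Eq42TorusConstraint (bondsIn)
open B10Eq38TorusDomains (toFine)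

variable {F : T4Family} {N : ℕ} [NeZero N]

/-- **★★★ THE KERNEL-LEVEL SOCKET FOR `avOfRecord` FROM A WINDOWED CHART OF THE INNER STEP** (the `hchartf` edition of FILE 6 ★★★): in the glue coordinates at `(sV, sV′)` of a
saturated `Y`, IF `(κ_f, Ψ_in, J_f, 𝒮_f)` charts the joint law of the INNER STEP `q ↦ (q.1, a_in q)` under `Π_{sV} Haar ⊗ Π_{sVᶜ} Haar` on the window `𝒮_f` with respect to the middle
reference `Π_{sV} Haar ⊗ Π_{sV′ᶜ} Haar` (FILE 1's `hchart` shape for the inner step; dag-n11-d's `hpush ∧ hfib` gives it by `chart_of_map_eq_restrict`), THEN FILE 1's `hchart` holds for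
`(avOfRecord F N K j).avg` at `(fieldMeasure j, fieldMeasure (j+1))` — FILE 3 ★★★ `chart_comp_of_disintegration` (outer step `avgRestrOfRecord × id`, un-charted) transported by FILE 6 §1.
[cite: Balaban1987RG1, (0.4) p.253; Balaban1988Convergent, (2.21) p.258, (3.1) p.264, (3.2)–(3.5) p.265, (3.10)–(3.11) p.266, p.267 L18–24] -/
theorem chart_avOfRecord_of_innerChart (K j : ℕ) [DecidableEq (PBond (F.P K) j)] [DecidableEq (PBond (F.P K) (j + 1))]
    (hj : j + 1 ≤ (F.P K).m + (F.P K).K)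
    {Y : Set (Site (F.P K) 0)} (hY : ∀ s : Site (F.P K) j, toFine j s ∈ Y ↔ toFine (j + 1) (blockOf s) ∈ Y)
    {sV : Finset (PBond (F.P K) j)} (hsV : ∀ b : PBond (F.P K) j, b ∈ bondsIn j Y → b ∈ sV)
    {sV' : Finset (PBond (F.P K) (j + 1))} (hsV' : ∀ c : PBond (F.P K) (j + 1), c ∈ sV' → c ∈ bondsIn (j + 1) Y)
    (hac_out : (Measure.pi fun _ : ↥sV => (HaarData.haar : Measure (SU N))).map (avgRestrOfRecord F N K j sV sV') ≪
      Measure.pi fun _ : ↥sV' => (HaarData.haar : Measure (SU N)))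
    {X : Type*} [MeasurableSpace X]
    {κf : Kernel ((↥sV → SU N) × ({c : PBond (F.P K) (j + 1) // c ∉ sV'} → SU N)) X} [IsSFiniteKernel κf]
    {Ψin : ((↥sV → SU N) × ({c : PBond (F.P K) (j + 1) // c ∉ sV'} → SU N)) × X → ({b : PBond (F.P K) j // b ∉ sV} → SU N)}
    {Jf : ((↥sV → SU N) × ({c : PBond (F.P K) (j + 1) // c ∉ sV'} → SU N)) × X → ℝ≥0}
    {𝒮f : Set (((↥sV → SU N) × ({c : PBond (F.P K) (j + 1) // c ∉ sV'} → SU N)) × ((↥sV → SU N) × ({b : PBond (F.P K) j // b ∉ sV} → SU N)))}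
    (hΨin : Measurable Ψin) (hJf : Measurable Jf) (h𝒮f : MeasurableSet 𝒮f)
    (hchartf : ((((Measure.pi fun _ : ↥sV => (HaarData.haar : Measure (SU N))).prod
          (Measure.pi fun _ : {c : PBond (F.P K) (j + 1) // c ∉ sV'} => (HaarData.haar : Measure (SU N)))) ⊗ₘ κf).withDensity
          (fun z => (Jf z : ℝ≥0∞))).map (fun z => (z.1, (z.1.1, Ψin z))) =
      (jointLaw ((Measure.pi fun _ : ↥sV => (HaarData.haar : Measure (SU N))).prod
          (Measure.pi fun _ : {b : PBond (F.P K) j // b ∉ sV} => (HaarData.haar : Measure (SU N))))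
        (fun u => (u.1, fun c : {c : PBond (F.P K) (j + 1) // c ∉ sV'} =>
          (avOfRecord F N K j).avg ((MeasurableEquiv.piEquivPiSubtypeProd (fun _ : PBond (F.P K) j => SU N) (· ∈ sV)).symm u) c))).restrict 𝒮f) :
    (((fieldMeasure (F.P K) (j + 1) (SU N)) ⊗ₘ
        (Kernel.comap
          ((Kernel.withDensity
              (condLaw ((Measure.pi fun _ : ↥sV => (HaarData.haar : Measure (SU N))).prod
                (Measure.pi fun _ : {c : PBond (F.P K) (j + 1) // c ∉ sV'} => (HaarData.haar : Measure (SU N))))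
                (Prod.map (avgRestrOfRecord F N K j sV sV') id))
              fun v _ => (margDensity ((Measure.pi fun _ : ↥sV => (HaarData.haar : Measure (SU N))).prod
                  (Measure.pi fun _ : {c : PBond (F.P K) (j + 1) // c ∉ sV'} => (HaarData.haar : Measure (SU N))))
                ((Measure.pi fun _ : ↥sV' => (HaarData.haar : Measure (SU N))).prod
                  (Measure.pi fun _ : {c : PBond (F.P K) (j + 1) // c ∉ sV'} => (HaarData.haar : Measure (SU N))))
                (Prod.map (avgRestrOfRecord F N K j sV sV') id) v : ℝ≥0∞)) ⊗ₖ
            Kernel.prodMkLeft ((↥sV' → SU N) × ({c : PBond (F.P K) (j + 1) // c ∉ sV'} → SU N)) κf)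
          (MeasurableEquiv.piEquivPiSubtypeProd (fun _ : PBond (F.P K) (j + 1) => SU N) (· ∈ sV'))
          (MeasurableEquiv.piEquivPiSubtypeProd (fun _ : PBond (F.P K) (j + 1) => SU N) (· ∈ sV')).measurable)).withDensity
        (fun z => (Jf z.2 : ℝ≥0∞))).map
        (fun z => (z.1, (MeasurableEquiv.piEquivPiSubtypeProd (fun _ : PBond (F.P K) j => SU N) (· ∈ sV)).symm (z.2.1.1, Ψin z.2))) =
      (jointLaw (fieldMeasure (F.P K) j (SU N)) (avOfRecord F N K j).avg).restrict
        {w : GaugeField (F.P K) (j + 1) (SU N) × GaugeField (F.P K) j (SU N) |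
          (((MeasurableEquiv.piEquivPiSubtypeProd (fun _ : PBond (F.P K) j => SU N) (· ∈ sV) w.2).1,
              fun c : {c : PBond (F.P K) (j + 1) // c ∉ sV'} => (avOfRecord F N K j).avg w.2 c),
            MeasurableEquiv.piEquivPiSubtypeProd (fun _ : PBond (F.P K) j => SU N) (· ∈ sV) w.2) ∈ 𝒮f} := by
  have ha₂ := measurable_avOfRecord_glue_rest F N K j sV sV'
  have hf : Measurable fun u : (↥sV → SU N) × ({b : PBond (F.P K) j // b ∉ sV} → SU N) =>
      (u.1, fun c : {c : PBond (F.P K) (j + 1) // c ∉ sV'} =>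
        (avOfRecord F N K j).avg ((MeasurableEquiv.piEquivPiSubtypeProd (fun _ : PBond (F.P K) j => SU N) (· ∈ sV)).symm u) c) :=
    measurable_fst.prodMk ha₂
  have hg : Measurable (Prod.map (avgRestrOfRecord F N K j sV sV') (id : ({c : PBond (F.P K) (j + 1) // c ∉ sV'} → SU N) → _)) :=
    (measurable_avgRestrOfRecord (F := F) (N := N) K j sV sV').prodMap measurable_id
  -- FILE 3 ★★★: compose with the un-charted outer step
  have h3 := chart_comp_of_disintegration
    (ν := (Measure.pi fun _ : ↥sV => (HaarData.haar : Measure (SU N))).prod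
      (Measure.pi fun _ : {b : PBond (F.P K) j // b ∉ sV} => (HaarData.haar : Measure (SU N))))
    (lam := (Measure.pi fun _ : ↥sV => (HaarData.haar : Measure (SU N))).prod
      (Measure.pi fun _ : {c : PBond (F.P K) (j + 1) // c ∉ sV'} => (HaarData.haar : Measure (SU N))))
    (μ := (Measure.pi fun _ : ↥sV' => (HaarData.haar : Measure (SU N))).prod
      (Measure.pi fun _ : {c : PBond (F.P K) (j + 1) // c ∉ sV'} => (HaarData.haar : Measure (SU N))))
    (κf := κf) (Ψf := fun z => (z.1.1, Ψin z)) (Jf := Jf) hf hg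
    (absolutelyContinuous_map_prodMap_id (measurable_avgRestrOfRecord (F := F) (N := N) K j sV sV') hac_out)
    (show Measurable (fun z : ((↥sV → SU N) × ({c : PBond (F.P K) (j + 1) // c ∉ sV'} → SU N)) × X => (z.1.1, Ψin z)) by fun_prop)
    hJf h𝒮f hchartf
  -- FILE 6 §1: transport along both glues with n11-e's skew intertwining
  have h1 := chart_of_equiv_presentation
    (MeasurableEquiv.piEquivPiSubtypeProd (fun _ : PBond (F.P K) (j + 1) => SU N) (· ∈ sV')).symm
    (MeasurableEquiv.piEquivPiSubtypeProd (fun _ : PBond (F.P K) j => SU N) (· ∈ sV)).symm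
    (avOfRecord_measurable F N K j) ((measurable_avgRestrOfRecord (F := F) (N := N) K j sV sV').comp measurable_fst |>.prodMk ha₂)
    (fun q => avOfRecord_glue_eq_glue F N K j hj hY hsV hsV' q)
    (show Measurable (fun z : ((↥sV' → SU N) × ({c : PBond (F.P K) (j + 1) // c ∉ sV'} → SU N)) ×
        (((↥sV → SU N) × ({c : PBond (F.P K) (j + 1) // c ∉ sV'} → SU N)) × X) => (z.2.1.1, Ψin z.2)) by fun_prop)
    (hJf.comp measurable_snd) ((hf.comp measurable_snd).prodMk measurable_snd h𝒮f) h3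
  rw [fieldMeasure_eq_map_piEquivPiSubtypeProd_symm (P := F.P K) (G := SU N) sV',
    fieldMeasure_eq_map_piEquivPiSubtypeProd_symm (P := F.P K) (G := SU N) sV]
  have hwin : {w : GaugeField (F.P K) (j + 1) (SU N) × GaugeField (F.P K) j (SU N) |
      (((MeasurableEquiv.piEquivPiSubtypeProd (fun _ : PBond (F.P K) j => SU N) (· ∈ sV) w.2).1,
          fun c : {c : PBond (F.P K) (j + 1) // c ∉ sV'} => (avOfRecord F N K j).avg w.2 c),
        MeasurableEquiv.piEquivPiSubtypeProd (fun _ : PBond (F.P K) j => SU N) (· ∈ sV) w.2) ∈ 𝒮f} =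
      {w : GaugeField (F.P K) (j + 1) (SU N) × GaugeField (F.P K) j (SU N) |
        ((MeasurableEquiv.piEquivPiSubtypeProd (fun _ : PBond (F.P K) (j + 1) => SU N) (· ∈ sV')).symm.symm w.1,
          (MeasurableEquiv.piEquivPiSubtypeProd (fun _ : PBond (F.P K) j => SU N) (· ∈ sV)).symm.symm w.2) ∈
          (fun p : ((↥sV' → SU N) × ({c : PBond (F.P K) (j + 1) // c ∉ sV'} → SU N)) ×
              ((↥sV → SU N) × ({b : PBond (F.P K) j // b ∉ sV} → SU N)) =>
            ((p.2.1, fun c : {c : PBond (F.P K) (j + 1) // c ∉ sV'} =>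
              (avOfRecord F N K j).avg ((MeasurableEquiv.piEquivPiSubtypeProd (fun _ : PBond (F.P K) j => SU N) (· ∈ sV)).symm p.2) c), p.2)) ⁻¹' 𝒮f} := by
    ext w
    simp only [Set.mem_setOf_eq, Set.mem_preimage, MeasurableEquiv.symm_symm, MeasurableEquiv.symm_apply_apply]
  rw [hwin]
  exact h1

/-! ## §2  INHABITED: dag-n11-w6's INNER private-coordinate chart (resample only the central bonds of the coarse bonds OFF `sV′`) -/

variable {K k : ℕ}
  (Ω T : PBond (F.P K) (k + 1) → GaugeField (F.P K) k (SU N) → Set (SU N))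
  (ϑ : PBond (F.P K) (k + 1) → GaugeField (F.P K) k (SU N) → SU N → SU N)
  (jd : PBond (F.P K) (k + 1) → GaugeField (F.P K) k (SU N) → SU N → ℝ≥0)

/-- **★★★ THE KERNEL-LEVEL SOCKET AT THE RECORD, INHABITED BY THE INNER PRIVATE-COORDINATE CHART** (dag-n11-w6 g2's `hpush_innerPrivateChart ∧ hfib_innerPrivateChart`, modulo the
displayed per-bond inversion data `(Ω, T, ϑ, j)` USED ONLY at the coarse bonds off `sV′`): with `X :=` the off-`sV` fine configurations, CONSTANT fibre kernel `Π_{sVᶜ} Haar`, inner chart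
`Ψ_in((y,v₂),r) := extend β′ (c ↦ ϑ_c(e_sV⁻¹(y,r), v₂ c)) r`, Jacobian `J((y,v₂),r) := 𝟙[∀ c ∉ sV′, v₂ c ∈ T_c(e_sV⁻¹(y,r))]·∏_{c ∉ sV′} j_c(e_sV⁻¹(y,r), v₂ c)` and window
`{(V, U) | ∀ c ∉ sV′, U(β c) ∈ Ω_c(U)}`, FILE 1's `hchart` holds for `(avOfRecord F N K k).avg` at `(fieldMeasure k, fieldMeasure (k+1))` — §1 on `chart_of_map_eq_restrict hpush hfib`.
[cite: Balaban1987RG1, (0.4) p.253, (2.4) p.266, (2.10) p.267; Balaban1988Convergent, (2.21) p.258, (3.1) p.264, (3.2)–(3.5) p.265, p.267 L18–24] -/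
theorem chart_avOfRecord_innerPrivateChart [DecidableEq (PBond (F.P K) k)] [DecidableEq (PBond (F.P K) (k + 1))] (hkK : k < K)
    {Y : Set (Site (F.P K) 0)} (hY : ∀ s : Site (F.P K) k, toFine k s ∈ Y ↔ toFine (k + 1) (blockOf s) ∈ Y)
    {sV : Finset (PBond (F.P K) k)} (hsV : ∀ b : PBond (F.P K) k, b ∈ bondsIn k Y → b ∈ sV)
    {sV' : Finset (PBond (F.P K) (k + 1))} (hsV' : ∀ c : PBond (F.P K) (k + 1), c ∈ sV' → c ∈ bondsIn (k + 1) Y)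
    (hβ' : ∀ c : PBond (F.P K) (k + 1), c ∉ sV' → centralBond c ∉ sV)
    (hac_out : (Measure.pi fun _ : ↥sV => (HaarData.haar : Measure (SU N))).map (avgRestrOfRecord F N K k sV sV') ≪
      Measure.pi fun _ : ↥sV' => (HaarData.haar : Measure (SU N)))
    (hΩm : ∀ c, MeasurableSet {p : GaugeField (F.P K) k (SU N) × SU N | p.2 ∈ Ω c p.1})
    (hTm : ∀ c, MeasurableSet {p : GaugeField (F.P K) k (SU N) × SU N | p.2 ∈ T c p.1})
    (hθm : ∀ c, Measurable fun p : GaugeField (F.P K) k (SU N) × SU N => ϑ c p.1 p.2)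
    (hjm : ∀ c, Measurable fun p : GaugeField (F.P K) k (SU N) × SU N => jd c p.1 p.2)
    (hΩbl : ∀ c (U : GaugeField (F.P K) k (SU N)) (g : PBond (F.P K) (k + 1) → SU N), Ω c (extend centralBond g U) = Ω c U)
    (hright : ∀ c U, ∀ v ∈ T c U, (avOfRecord F N K k).avg (update U (centralBond c) (ϑ c U v)) c = v)
    (hlaw : ∀ c U, (HaarData.haar : Measure (SU N)).restrict (Ω c U) =
      (((HaarData.haar : Measure (SU N)).restrict (T c U)).withDensity fun v => (jd c U v : ℝ≥0∞)).map (ϑ c U)) :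
    (((fieldMeasure (F.P K) (k + 1) (SU N)) ⊗ₘ
        (Kernel.comap
          ((Kernel.withDensity
              (condLaw ((Measure.pi fun _ : ↥sV => (HaarData.haar : Measure (SU N))).prod
                (Measure.pi fun _ : {c : PBond (F.P K) (k + 1) // c ∉ sV'} => (HaarData.haar : Measure (SU N))))
                (Prod.map (avgRestrOfRecord F N K k sV sV') id))
              fun v _ => (margDensity ((Measure.pi fun _ : ↥sV => (HaarData.haar : Measure (SU N))).prod
                  (Measure.pi fun _ : {c : PBond (F.P K) (k + 1) // c ∉ sV'} => (HaarData.haar : Measure (SU N))))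
                ((Measure.pi fun _ : ↥sV' => (HaarData.haar : Measure (SU N))).prod
                  (Measure.pi fun _ : {c : PBond (F.P K) (k + 1) // c ∉ sV'} => (HaarData.haar : Measure (SU N))))
                (Prod.map (avgRestrOfRecord F N K k sV sV') id) v : ℝ≥0∞)) ⊗ₖ
            Kernel.prodMkLeft ((↥sV' → SU N) × ({c : PBond (F.P K) (k + 1) // c ∉ sV'} → SU N))
              (Kernel.const ((↥sV → SU N) × ({c : PBond (F.P K) (k + 1) // c ∉ sV'} → SU N))
                (Measure.pi fun _ : {b : PBond (F.P K) k // b ∉ sV} => (HaarData.haar : Measure (SU N)))))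
          (MeasurableEquiv.piEquivPiSubtypeProd (fun _ : PBond (F.P K) (k + 1) => SU N) (· ∈ sV'))
          (MeasurableEquiv.piEquivPiSubtypeProd (fun _ : PBond (F.P K) (k + 1) => SU N) (· ∈ sV')).measurable)).withDensity
        (fun z => (({z : ((↥sV → SU N) × ({c : PBond (F.P K) (k + 1) // c ∉ sV'} → SU N)) × ({b : PBond (F.P K) k // b ∉ sV} → SU N) |
              ∀ c : {c : PBond (F.P K) (k + 1) // c ∉ sV'},
                z.1.2 c ∈ T c ((MeasurableEquiv.piEquivPiSubtypeProd (fun _ : PBond (F.P K) k => SU N) (· ∈ sV)).symm (z.1.1, z.2))}.indicator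
            (fun z => ∏ c : {c : PBond (F.P K) (k + 1) // c ∉ sV'},
              jd c ((MeasurableEquiv.piEquivPiSubtypeProd (fun _ : PBond (F.P K) k => SU N) (· ∈ sV)).symm (z.1.1, z.2)) (z.1.2 c)) z.2 : ℝ≥0) : ℝ≥0∞))).map
        (fun z => (z.1, (MeasurableEquiv.piEquivPiSubtypeProd (fun _ : PBond (F.P K) k => SU N) (· ∈ sV)).symm (z.2.1.1,
          extend (fun c : {c : PBond (F.P K) (k + 1) // c ∉ sV'} =>
              (⟨centralBond (c : PBond (F.P K) (k + 1)), hβ' c c.2⟩ : {b : PBond (F.P K) k // b ∉ sV}))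
            (fun c : {c : PBond (F.P K) (k + 1) // c ∉ sV'} =>
              ϑ c ((MeasurableEquiv.piEquivPiSubtypeProd (fun _ : PBond (F.P K) k => SU N) (· ∈ sV)).symm (z.2.1.1, z.2.2)) (z.2.1.2 c)) z.2.2))) =
      (jointLaw (fieldMeasure (F.P K) k (SU N)) (avOfRecord F N K k).avg).restrict
        {w : GaugeField (F.P K) (k + 1) (SU N) × GaugeField (F.P K) k (SU N) |
          (((MeasurableEquiv.piEquivPiSubtypeProd (fun _ : PBond (F.P K) k => SU N) (· ∈ sV) w.2).1,
              fun c : {c : PBond (F.P K) (k + 1) // c ∉ sV'} => (avOfRecord F N K k).avg w.2 c),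
            MeasurableEquiv.piEquivPiSubtypeProd (fun _ : PBond (F.P K) k => SU N) (· ∈ sV) w.2) ∈
          (Prod.snd ⁻¹' {q : (↥sV → SU N) × ({b : PBond (F.P K) k // b ∉ sV} → SU N) |
            ∀ c : {c : PBond (F.P K) (k + 1) // c ∉ sV'},
              q.2 ⟨centralBond (c : PBond (F.P K) (k + 1)), hβ' c c.2⟩ ∈
                Ω c ((MeasurableEquiv.piEquivPiSubtypeProd (fun _ : PBond (F.P K) k => SU N) (· ∈ sV)).symm q)} :
            Set (((↥sV → SU N) × ({c : PBond (F.P K) (k + 1) // c ∉ sV'} → SU N)) × ((↥sV → SU N) × ({b : PBond (F.P K) k // b ∉ sV} → SU N))))} := by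
  have hk : k + 1 ≤ (F.P K).m + (F.P K).K := succ_le_m_add_K hkK
  have ha₂ := measurable_avOfRecord_glue_rest F N K k sV sV'
  have hf : Measurable fun u : (↥sV → SU N) × ({b : PBond (F.P K) k // b ∉ sV} → SU N) =>
      (u.1, fun c : {c : PBond (F.P K) (k + 1) // c ∉ sV'} =>
        (avOfRecord F N K k).avg ((MeasurableEquiv.piEquivPiSubtypeProd (fun _ : PBond (F.P K) k => SU N) (· ∈ sV)).symm u) c) :=
    measurable_fst.prodMk ha₂
  have hΨ := measurable_innerPrivateChart (F := F) (N := N) ϑ hk hβ' hθm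
  have hJ := measurable_innerPrivateJacobian (F := F) (N := N) (sV := sV) (sV' := sV') T jd hTm hjm
  have hS : MeasurableSet {q : (↥sV → SU N) × ({b : PBond (F.P K) k // b ∉ sV} → SU N) |
      ∀ c : {c : PBond (F.P K) (k + 1) // c ∉ sV'},
        q.2 ⟨centralBond (c : PBond (F.P K) (k + 1)), hβ' c c.2⟩ ∈
          Ω c ((MeasurableEquiv.piEquivPiSubtypeProd (fun _ : PBond (F.P K) k => SU N) (· ∈ sV)).symm q)} := by
    have he : Measurable fun q : (↥sV → SU N) × ({b : PBond (F.P K) k // b ∉ sV} → SU N) =>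
        (MeasurableEquiv.piEquivPiSubtypeProd (fun _ : PBond (F.P K) k => SU N) (· ∈ sV)).symm q :=
      (MeasurableEquiv.piEquivPiSubtypeProd (fun _ : PBond (F.P K) k => SU N) (· ∈ sV)).symm.measurable
    have h1 : {q : (↥sV → SU N) × ({b : PBond (F.P K) k // b ∉ sV} → SU N) |
        ∀ c : {c : PBond (F.P K) (k + 1) // c ∉ sV'},
          q.2 ⟨centralBond (c : PBond (F.P K) (k + 1)), hβ' c c.2⟩ ∈
            Ω c ((MeasurableEquiv.piEquivPiSubtypeProd (fun _ : PBond (F.P K) k => SU N) (· ∈ sV)).symm q)} =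
        ⋂ c : {c : PBond (F.P K) (k + 1) // c ∉ sV'}, (fun q : (↥sV → SU N) × ({b : PBond (F.P K) k // b ∉ sV} → SU N) =>
          ((MeasurableEquiv.piEquivPiSubtypeProd (fun _ : PBond (F.P K) k => SU N) (· ∈ sV)).symm q,
            q.2 ⟨centralBond (c : PBond (F.P K) (k + 1)), hβ' c c.2⟩)) ⁻¹' {p : GaugeField (F.P K) k (SU N) × SU N | p.2 ∈ Ω c p.1} := by
      ext q
      simp only [Set.mem_setOf_eq, Set.mem_iInter, Set.mem_preimage]
      rfl
    rw [h1]
    exact MeasurableSet.iInter fun c => (he.prodMk ((measurable_pi_apply _).comp measurable_snd)) (hΩm c)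
  -- the inner-step `hchartf` from dag-n11-w6's `hpush ∧ hfib` (FILE 1 `chart_of_map_eq_restrict`)
  have hchartf := chart_of_map_eq_restrict
    (ν := (Measure.pi fun _ : ↥sV => (HaarData.haar : Measure (SU N))).prod
      (Measure.pi fun _ : {b : PBond (F.P K) k // b ∉ sV} => (HaarData.haar : Measure (SU N))))
    (μ := (Measure.pi fun _ : ↥sV => (HaarData.haar : Measure (SU N))).prod
      (Measure.pi fun _ : {c : PBond (F.P K) (k + 1) // c ∉ sV'} => (HaarData.haar : Measure (SU N))))
    (κ := Kernel.const ((↥sV → SU N) × ({c : PBond (F.P K) (k + 1) // c ∉ sV'} → SU N))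
      (Measure.pi fun _ : {b : PBond (F.P K) k // b ∉ sV} => (HaarData.haar : Measure (SU N))))
    hf ((measurable_fst.comp measurable_fst).prodMk hΨ) hS
    (hpush_innerPrivateChart (F := F) (N := N) Ω T ϑ jd hkK hβ' hΩm hTm hθm hjm hΩbl hright hlaw)
    (by
      filter_upwards [hfib_innerPrivateChart (F := F) (N := N) T ϑ jd hkK hβ' hTm hjm hright
        (((Measure.pi fun _ : ↥sV => (HaarData.haar : Measure (SU N))).prod
          (Measure.pi fun _ : {c : PBond (F.P K) (k + 1) // c ∉ sV'} => (HaarData.haar : Measure (SU N)))) ⊗ₘ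
          Kernel.const ((↥sV → SU N) × ({c : PBond (F.P K) (k + 1) // c ∉ sV'} → SU N))
            (Measure.pi fun _ : {b : PBond (F.P K) k // b ∉ sV} => (HaarData.haar : Measure (SU N))))] with z hz
      exact Prod.ext rfl hz)
  exact chart_avOfRecord_of_innerChart (F := F) (N := N) K k hk hY hsV hsV' hac_out hΨ hJ (measurable_snd hS) hchartf

/-! ## §3  def-T's (†) FOR ALL NEW SEQUENCES AT ONCE, SEPARATED AS IN [III] §3: `𝐓^{(k)}` (11a's `kernelRTOfRecord`) of the INNER private-coordinate chart integral -/

/-- **★★★ def-T's (†) AT THE RECORD = 11a's RESTRICTED TRANSPORT OF THE INNER PRIVATE-CHART INTEGRAL, ALL `s′` AT ONCE**: at step `k < p.K`, for a fine region `Y` saturated at level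
`k+1` with bond sets `sV ⊇ bondsIn k Y`, `sV′ ⊆ bondsIn (k+1) Y`, `hβ′` (inside coarse bonds have inside central bonds), per-bond inversion data `(Ω, T, ϑ, j)` USED ONLY off `sV′`, step
weights with measurable sections and the SUPPORT CLAUSE on the INNER bonds «`w_k(s′)(U, V′) ≠ 0 ⇒ ∀ c ∉ sV′, U(β c) ∈ Ω_c(U)`» ((3.2)–(3.5) — DISPLAYED), measurable `χ_k(s)`, `T(s)`
and GRAPH-integrable (†) integrands: for `dV′`-a.e. `V′` and EVERY `s′`, with `(o, r) := e_α⁻¹V′` and `e = e_sV⁻¹`,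
`(𝐓e^A)_{k+1}(s′)(V′) = kernelRTOfRecord F N K k sV sV′ (y ↦ ∫ dU_in 𝟙[∀ c ∉ sV′, r c ∈ T_c(e(y,U_in))]·∏_{c ∉ sV′} j_c(e(y,U_in), r c) · (w(s′)(·,V′)·χ_k·T)(e(y, extend β′ (ϑ_c(e(y,U_in), r c))_c U_in))) o`
— [III] (2.21)∕(3.1) «`∫dV_k|_{Ω^c} δ(V̄_k V_{k+1}⁻¹) … ∫dU|_{Ω} δ(…)`» with the inside δ-functions removed by SOLVING `Ū′(c) = V′(c)` for the central bonds of the inside coarse bonds.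
FILE 8 ★★★ at §2's chart (`Kernel.const_apply`). [cite: Balaban1988Convergent, (2.18) p.257, (2.21) p.258, (3.1) p.264, (3.2)–(3.5) p.265, p.267 L18–24; Balaban1987RG1, (0.4) p.253, (2.10) p.267] -/
theorem ae_forall_tstepOfRecord_eq_kernelRTOfRecord_innerPrivateChart (p : B12.RunParams) {k : ℕ} [DecidableEq (PBond (F.P p.K) k)]
    [DecidableEq (PBond (F.P p.K) (k + 1))]
    (Ω T : PBond (F.P p.K) (k + 1) → GaugeField (F.P p.K) k (SU N) → Set (SU N))
    (ϑ : PBond (F.P p.K) (k + 1) → GaugeField (F.P p.K) k (SU N) → SU N → SU N)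
    (jd : PBond (F.P p.K) (k + 1) → GaugeField (F.P p.K) k (SU N) → SU N → ℝ≥0)
    (ν : Stage7Numerics) (M : ℕ) (w : StepWeightsOfRecord F N ν M) (g : ℕ → ℝ) (hk : k < p.K) (T' : SeqOfRecord F ν M g p.K k → Density (F.P p.K) k (SU N))
    {Y : Set (Site (F.P p.K) 0)} (hY : ∀ s : Site (F.P p.K) k, toFine k s ∈ Y ↔ toFine (k + 1) (blockOf s) ∈ Y)
    {sV : Finset (PBond (F.P p.K) k)} (hsV : ∀ b : PBond (F.P p.K) k, b ∈ bondsIn k Y → b ∈ sV)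
    {sV' : Finset (PBond (F.P p.K) (k + 1))} (hsV' : ∀ c : PBond (F.P p.K) (k + 1), c ∈ sV' → c ∈ bondsIn (k + 1) Y)
    (hβ' : ∀ c : PBond (F.P p.K) (k + 1), c ∉ sV' → centralBond c ∉ sV)
    (hac_out : (Measure.pi fun _ : ↥sV => (HaarData.haar : Measure (SU N))).map (avgRestrOfRecord F N p.K k sV sV') ≪
      Measure.pi fun _ : ↥sV' => (HaarData.haar : Measure (SU N)))
    (hΩm : ∀ c, MeasurableSet {q : GaugeField (F.P p.K) k (SU N) × SU N | q.2 ∈ Ω c q.1})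
    (hTm : ∀ c, MeasurableSet {q : GaugeField (F.P p.K) k (SU N) × SU N | q.2 ∈ T c q.1})
    (hθm : ∀ c, Measurable fun q : GaugeField (F.P p.K) k (SU N) × SU N => ϑ c q.1 q.2)
    (hjm : ∀ c, Measurable fun q : GaugeField (F.P p.K) k (SU N) × SU N => jd c q.1 q.2)
    (hΩbl : ∀ c (U : GaugeField (F.P p.K) k (SU N)) (g' : PBond (F.P p.K) (k + 1) → SU N), Ω c (extend centralBond g' U) = Ω c U)
    (hright : ∀ c U, ∀ v ∈ T c U, (avOfRecord F N p.K k).avg (update U (centralBond c) (ϑ c U v)) c = v)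
    (hlaw : ∀ c U, (HaarData.haar : Measure (SU N)).restrict (Ω c U) =
      (((HaarData.haar : Measure (SU N)).restrict (T c U)).withDensity fun v => (jd c U v : ℝ≥0∞)).map (ϑ c U))
    (hw : ∀ s' V', Measurable fun U => w p g k s' U V') (hwj : ∀ s', Measurable fun q : GaugeField (F.P p.K) (k + 1) (SU N) × GaugeField (F.P p.K) k (SU N) =>
      w p g k s' q.2 q.1)
    (hχ : ∀ s, Measurable (chiSeqOfRecord F N ν M g p.K k s)) (hT : ∀ s, Measurable (T' s))
    (hwΩ : ∀ s' (U : GaugeField (F.P p.K) k (SU N)) V', w p g k s' U V' ≠ 0 → ∀ c : PBond (F.P p.K) (k + 1), c ∉ sV' → U (centralBond c) ∈ Ω c U)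
    (hGi : ∀ s' : SeqOfRecord F ν M g p.K (k + 1),
      Integrable (fun U => w p g k s' U ((avOfRecord F N p.K k).avg U) * (chiSeqOfRecord F N ν M g p.K k s'.init U * T' s'.init U))
        (fieldMeasure (F.P p.K) k (SU N))) :
    ∀ᵐ V' ∂(fieldMeasure (F.P p.K) (k + 1) (SU N)), ∀ s' : SeqOfRecord F ν M g p.K (k + 1),
      tstepOfRecord F N ν M w p g k T' s' V' =
        kernelRTOfRecord F N p.K k sV sV'
          (fun y => ∫ uin,
            (({z : ((↥sV → SU N) × ({c : PBond (F.P p.K) (k + 1) // c ∉ sV'} → SU N)) × ({b : PBond (F.P p.K) k // b ∉ sV} → SU N) |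
                ∀ c : {c : PBond (F.P p.K) (k + 1) // c ∉ sV'},
                  z.1.2 c ∈ T c ((MeasurableEquiv.piEquivPiSubtypeProd (fun _ : PBond (F.P p.K) k => SU N) (· ∈ sV)).symm (z.1.1, z.2))}.indicator
              (fun z => ∏ c : {c : PBond (F.P p.K) (k + 1) // c ∉ sV'},
                jd c ((MeasurableEquiv.piEquivPiSubtypeProd (fun _ : PBond (F.P p.K) k => SU N) (· ∈ sV)).symm (z.1.1, z.2)) (z.1.2 c))
              ((y, (MeasurableEquiv.piEquivPiSubtypeProd (fun _ : PBond (F.P p.K) (k + 1) => SU N) (· ∈ sV') V').2), uin) : ℝ≥0) : ℝ) *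
            ((fun U : GaugeField (F.P p.K) k (SU N) => w p g k s' U V' * (chiSeqOfRecord F N ν M g p.K k s'.init U * T' s'.init U))
              ((MeasurableEquiv.piEquivPiSubtypeProd (fun _ : PBond (F.P p.K) k => SU N) (· ∈ sV)).symm (y,
                extend (fun c : {c : PBond (F.P p.K) (k + 1) // c ∉ sV'} =>
                    (⟨centralBond (c : PBond (F.P p.K) (k + 1)), hβ' c c.2⟩ : {b : PBond (F.P p.K) k // b ∉ sV}))
                  (fun c : {c : PBond (F.P p.K) (k + 1) // c ∉ sV'} =>
                    ϑ c ((MeasurableEquiv.piEquivPiSubtypeProd (fun _ : PBond (F.P p.K) k => SU N) (· ∈ sV)).symm (y, uin))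
                      ((MeasurableEquiv.piEquivPiSubtypeProd (fun _ : PBond (F.P p.K) (k + 1) => SU N) (· ∈ sV') V').2 c)) uin)))
            ∂(Measure.pi fun _ : {b : PBond (F.P p.K) k // b ∉ sV} => (HaarData.haar : Measure (SU N))))
          (MeasurableEquiv.piEquivPiSubtypeProd (fun _ : PBond (F.P p.K) (k + 1) => SU N) (· ∈ sV') V').1 := by
  have hk' : k + 1 ≤ (F.P p.K).m + (F.P p.K).K := succ_le_m_add_K hk
  have hchart := chart_avOfRecord_innerPrivateChart (F := F) (N := N) Ω T ϑ jd hk hY hsV hsV' hβ' hac_out hΩm hTm hθm hjm hΩbl hright hlaw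
  have hΨ := measurable_innerPrivateChart (F := F) (N := N) ϑ hk' hβ' hθm
  have hJ := measurable_innerPrivateJacobian (F := F) (N := N) (sV := sV) (sV' := sV') T jd hTm hjm
  -- the record window is measurable
  have hE : Measurable fun w : GaugeField (F.P p.K) (k + 1) (SU N) × GaugeField (F.P p.K) k (SU N) =>
      MeasurableEquiv.piEquivPiSubtypeProd (fun _ : PBond (F.P p.K) k => SU N) (· ∈ sV) w.2 :=
    (MeasurableEquiv.measurable _).comp measurable_snd
  have h𝒮 := (Measurable.prodMk (Measurable.prodMk (measurable_fst.comp hE)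
      (measurable_pi_lambda _ fun c => (measurable_pi_apply (c : PBond (F.P p.K) (k + 1))).comp
        ((avOfRecord_measurable F N p.K k).comp measurable_snd))) hE)
    (measurable_snd
      (show MeasurableSet {q : (↥sV → SU N) × ({b : PBond (F.P p.K) k // b ∉ sV} → SU N) |
          ∀ c : {c : PBond (F.P p.K) (k + 1) // c ∉ sV'},
            q.2 ⟨centralBond (c : PBond (F.P p.K) (k + 1)), hβ' c c.2⟩ ∈
              Ω c ((MeasurableEquiv.piEquivPiSubtypeProd (fun _ : PBond (F.P p.K) k => SU N) (· ∈ sV)).symm q)} from by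
        have he : Measurable fun q : (↥sV → SU N) × ({b : PBond (F.P p.K) k // b ∉ sV} → SU N) =>
            (MeasurableEquiv.piEquivPiSubtypeProd (fun _ : PBond (F.P p.K) k => SU N) (· ∈ sV)).symm q :=
          (MeasurableEquiv.piEquivPiSubtypeProd (fun _ : PBond (F.P p.K) k => SU N) (· ∈ sV)).symm.measurable
        have h1 : {q : (↥sV → SU N) × ({b : PBond (F.P p.K) k // b ∉ sV} → SU N) |
            ∀ c : {c : PBond (F.P p.K) (k + 1) // c ∉ sV'},
              q.2 ⟨centralBond (c : PBond (F.P p.K) (k + 1)), hβ' c c.2⟩ ∈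
                Ω c ((MeasurableEquiv.piEquivPiSubtypeProd (fun _ : PBond (F.P p.K) k => SU N) (· ∈ sV)).symm q)} =
            ⋂ c : {c : PBond (F.P p.K) (k + 1) // c ∉ sV'}, (fun q : (↥sV → SU N) × ({b : PBond (F.P p.K) k // b ∉ sV} → SU N) =>
              ((MeasurableEquiv.piEquivPiSubtypeProd (fun _ : PBond (F.P p.K) k => SU N) (· ∈ sV)).symm q,
                q.2 ⟨centralBond (c : PBond (F.P p.K) (k + 1)), hβ' c c.2⟩)) ⁻¹' {p : GaugeField (F.P p.K) k (SU N) × SU N | p.2 ∈ Ω c p.1} := by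
          ext q
          simp only [Set.mem_setOf_eq, Set.mem_iInter, Set.mem_preimage]
          rfl
        rw [h1]
        exact MeasurableSet.iInter fun c => (he.prodMk ((measurable_pi_apply _).comp measurable_snd)) (hΩm c)))
  -- the support clause on the record window
  have hwS : ∀ s' (U : GaugeField (F.P p.K) k (SU N)) V', (V', U) ∉
      {w : GaugeField (F.P p.K) (k + 1) (SU N) × GaugeField (F.P p.K) k (SU N) |
        (((MeasurableEquiv.piEquivPiSubtypeProd (fun _ : PBond (F.P p.K) k => SU N) (· ∈ sV) w.2).1,
            fun c : {c : PBond (F.P p.K) (k + 1) // c ∉ sV'} => (avOfRecord F N p.K k).avg w.2 c),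
          MeasurableEquiv.piEquivPiSubtypeProd (fun _ : PBond (F.P p.K) k => SU N) (· ∈ sV) w.2) ∈
        (Prod.snd ⁻¹' {q : (↥sV → SU N) × ({b : PBond (F.P p.K) k // b ∉ sV} → SU N) |
          ∀ c : {c : PBond (F.P p.K) (k + 1) // c ∉ sV'},
            q.2 ⟨centralBond (c : PBond (F.P p.K) (k + 1)), hβ' c c.2⟩ ∈
              Ω c ((MeasurableEquiv.piEquivPiSubtypeProd (fun _ : PBond (F.P p.K) k => SU N) (· ∈ sV)).symm q)} :
          Set (((↥sV → SU N) × ({c : PBond (F.P p.K) (k + 1) // c ∉ sV'} → SU N)) × ((↥sV → SU N) × ({b : PBond (F.P p.K) k // b ∉ sV} → SU N))))} →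
      w p g k s' U V' = 0 := by
    intro s' U V' hU
    by_contra h
    apply hU
    simp only [Set.mem_setOf_eq, Set.mem_preimage, MeasurableEquiv.symm_apply_apply]
    intro c
    exact hwΩ s' U V' h c c.2
  filter_upwards [ae_forall_tstepOfRecord_eq_kernelRTOfRecord_glue_of_integrable_graph (F := F) (N := N) p ν M w g hk T' sV sV' hac_out
    hΨ hJ h𝒮 hchart hw hwj hχ hT hwS hGi] with V' hV' s'
  rw [hV' s']
  simp only [Kernel.const_apply]

end Record

end Summit.QuantumFields.YangMills.Theorems.BalabanUVNodesN11TStepInnerPrivateCoordinateChart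

end
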